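import Summits.AnomalousDissipation.AnomalousDissipation.Theorems.MarginalStabilityChainBurgersLayerKHLine

/-!
# Stub `stub_volterra` of the line `Sketch` (crux stmt-AnomalousDissipation-3008), part A:
# the kernel `k_α`, the Bielecki weight, and the Volterra operator (integrability, weighted bound, continuity)

Registered stub (proved in `MarginalStabilityChainBurgersLayerKHStubVolterra.lean`, which imports this file):
`theorem stub_volterra : ∀ k : ℕ, 1 ≤ k → ∀ A : ℝ, VolterraPackage k A` — the weighted Volterra theory on
the whole line of the Jost equation `m(y) = g(y) + ∫_{t>y} k_α(t-y) V(t) m(t) dt`,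
`k_α(u) = (1 - e^{-2αu})/(2α) ∈ [0, u]`, with a Gaussian-class potential `‖V t‖ ≤ A e^{-t²/4}` and data
`‖g y‖ ≤ (1+|y|)^k`: existence with an `α`-UNIFORM constant and uniqueness among continuous functions of
polynomial growth of order `k` (`k ≥ 1`).

Method: a Bielecki-weighted contraction instead of the factorial bounds of the Picard iteration.  With
`a(t) = A(1+|t|)^{k+1} e^{-t²/4} ∈ L¹(ℝ)` and the weight `W(y) = exp(2∫_{t>y} a)` one has `1 ≤ W ≤ e^{2‖a‖₁}`
and `∫_{t>y} a W = (W(y) - 1)/2` (fundamental theorem of calculus on `(y, ∞)`), so the elementary bound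
`k_α(t-y) ≤ t - y ≤ (1+|y|)(1+|t|)` gives, whenever `‖f t‖ ≤ D (1+|t|)^k W(t)`,
`‖(Kf)(y)‖ ≤ (1+|y|) D ∫_{t>y} a W ≤ (D/2) (1+|y|)^k W(y)`: the Volterra operator
`(Kf)(y) = ∫_{t>y} k_α(t-y) V(t) f(t) dt` is a `1/2`-contraction in the sup norm with weight `(1+|y|)^k W`,
uniformly in `α ≥ 0` (no upper bound on `α` is needed).

Contents: §1 kernel facts (`k_α(0) = 0`, `0 ≤ k_α(u) ≤ u`, continuity, the pointwise bound on the
integrand); §2 `(1+|t|)^n e^{-t²/4} ∈ L¹` and the weight `exists_weight`; §3 integrability of the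
integrand on `(y, ∞)`, the weighted bound `norm_volterra_le`, continuity of `Kf` (dominated convergence
for `∫_ℝ k_α((t-y)₊) V f`, jointly continuous because `k_α(0) = 0`), and the registered sub-goal
`volterra_partA` (Pi-form of `continuous_volterra`).  Part B builds the contraction on `ℝ →ᵇ ℂ` and the
package.  Pure proof file (no definitions); Mathlib only.
-/

-- `Summit.<Summit>.<Problem>` is the tree's mandated summit-side namespace (CONVENTIONS §2); for this
-- single-conjunct summit the two coincide, so the duplicate is deliberate.
set_option linter.dupNamespace false

noncomputable section

open Complex MeasureTheory Filter Topology Set Metric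

namespace Summit.AnomalousDissipation.AnomalousDissipation.Theorems.BurgersLayerKH.Sheet.Volterra

/-! ## §1 The kernel `k_α(u) = (1 - e^{-2αu})/(2α)` -/

/-- `k_α(0) = 0`. [folklore] -/
theorem volterraKernel_zero (α : ℝ) : volterraKernel α 0 = 0 := by
  unfold volterraKernel
  split_ifs <;> simp

/-- `0 ≤ k_α(u)` for `u ≥ 0`, `α ≥ 0`. [folklore] -/
theorem volterraKernel_nonneg {α u : ℝ} (hα : 0 ≤ α) (hu : 0 ≤ u) : 0 ≤ volterraKernel α u := by
  unfold volterraKernel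
  split_ifs with h
  · exact hu
  · have hα' : 0 < α := lt_of_le_of_ne hα (Ne.symm h)
    refine div_nonneg ?_ (by positivity)
    rw [sub_nonneg, Real.exp_le_one_iff]
    nlinarith

/-- `k_α(u) ≤ u` for `α ≥ 0` (all `u`: `1 - e^{-x} ≤ x`). [folklore] -/
theorem volterraKernel_le {α u : ℝ} (hα : 0 ≤ α) : volterraKernel α u ≤ u := by
  unfold volterraKernel
  split_ifs with h
  · exact le_rfl
  · have hα' : 0 < α := lt_of_le_of_ne hα (Ne.symm h)
    rw [div_le_iff₀ (by positivity)]
    have := Real.add_one_le_exp (-(2 * α * u))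
    nlinarith

/-- `k_α` is continuous. [folklore] -/
theorem continuous_volterraKernel (α : ℝ) : Continuous (volterraKernel α) := by
  by_cases h : α = 0
  · have : volterraKernel α = fun u => u := funext fun u => by simp [volterraKernel, h]
    rw [this]
    exact continuous_id
  · have : volterraKernel α = fun u => (1 - Real.exp (-(2 * α * u))) / (2 * α) :=
      funext fun u => by simp [volterraKernel, h]
    rw [this]
    fun_prop

/-- Pointwise bound on the Volterra integrand for `t > y`:
`‖k_α(t-y) V(t) f(t)‖ ≤ (1+|y|) (1+|t|) A e^{-t²/4} ‖f t‖` (`k_α(t-y) ≤ t - y ≤ (1+|y|)(1+|t|)`).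
[folklore] -/
theorem norm_integrand_le {A α : ℝ} {V : ℝ → ℂ} (hα : 0 ≤ α)
    (hVb : ∀ t, ‖V t‖ ≤ A * Real.exp (-(t ^ 2) / 4)) (f : ℝ → ℂ) {y t : ℝ} (ht : y < t) :
    ‖(volterraKernel α (t - y) : ℂ) * V t * f t‖ ≤
      (1 + |y|) * ((1 + |t|) * (A * Real.exp (-(t ^ 2) / 4))) * ‖f t‖ := by
  have h0 := volterraKernel_nonneg hα (sub_nonneg.2 ht.le)
  have h1 : volterraKernel α (t - y) ≤ (1 + |y|) * (1 + |t|) :=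
    (volterraKernel_le hα).trans
      (by nlinarith [le_abs_self t, neg_le_abs y, mul_nonneg (abs_nonneg y) (abs_nonneg t)])
  have h2 := hVb t
  rw [norm_mul, norm_mul, Complex.norm_of_nonneg h0]
  calc volterraKernel α (t - y) * ‖V t‖ * ‖f t‖
      ≤ (1 + |y|) * (1 + |t|) * (A * Real.exp (-(t ^ 2) / 4)) * ‖f t‖ := by gcongr
    _ = _ := by ring

/-! ## §2 Gaussian moments and the Bielecki weight -/

/-- `(1+|t|)^n e^{-t²/4}` is integrable on `ℝ` (it is bounded by `e^{2n²} e^{-t²/8}`). [folklore] -/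
theorem integrable_pow_mul_gauss (n : ℕ) :
    Integrable fun t : ℝ => (1 + |t|) ^ n * Real.exp (-(t ^ 2) / 4) := by
  have hg : Integrable fun t : ℝ => Real.exp (2 * (n : ℝ) ^ 2) * Real.exp (-(1 / 8) * t ^ 2) :=
    (integrable_exp_neg_mul_sq (by norm_num : (0 : ℝ) < 1 / 8)).const_mul _
  refine hg.mono' (Continuous.aestronglyMeasurable (by fun_prop)) (Eventually.of_forall fun t => ?_)
  rw [Real.norm_of_nonneg (by positivity)]
  have h1 : (1 + |t|) ^ n ≤ Real.exp (n * |t|) := by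
    calc (1 + |t|) ^ n ≤ (Real.exp |t|) ^ n := by
          gcongr
          linarith [Real.add_one_le_exp |t|]
      _ = Real.exp (n * |t|) := (Real.exp_nat_mul _ _).symm
  have h2 : (n : ℝ) * |t| + -(t ^ 2) / 4 ≤ 2 * (n : ℝ) ^ 2 + -(1 / 8) * t ^ 2 := by
    nlinarith [sq_nonneg (|t| - 4 * n), sq_abs t]
  calc (1 + |t|) ^ n * Real.exp (-(t ^ 2) / 4)
      ≤ Real.exp (n * |t|) * Real.exp (-(t ^ 2) / 4) := by gcongr
    _ = Real.exp (n * |t| + -(t ^ 2) / 4) := (Real.exp_add _ _).symm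
    _ ≤ Real.exp (2 * (n : ℝ) ^ 2 + -(1 / 8) * t ^ 2) := Real.exp_le_exp.2 h2
    _ = Real.exp (2 * (n : ℝ) ^ 2) * Real.exp (-(1 / 8) * t ^ 2) := Real.exp_add _ _

/-- **Bielecki weight.** For a continuous integrable `a ≥ 0` on `ℝ`, the weight
`W(y) = exp(2 ∫_{t>y} a)` is continuous, `1 ≤ W ≤ exp(2∫a)`, and `∫_{t>y} a W ≤ W(y)/2`
(fundamental theorem of calculus on `(y, ∞)` for `-W/2`, whose derivative is `a W`). [folklore] -/
theorem exists_weight {a : ℝ → ℝ} (hac : Continuous a) (ha0 : ∀ t, 0 ≤ a t) (hai : Integrable a) :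
    ∃ W : ℝ → ℝ, Continuous W ∧ (∀ y, 1 ≤ W y) ∧ (∀ y, W y ≤ Real.exp (2 * ∫ t, a t)) ∧
      ∀ y, IntegrableOn (fun t => a t * W t) (Ioi y) ∧ ∫ t in Ioi y, a t * W t ≤ W y / 2 := by
  obtain ⟨P, hP⟩ : ∃ P : ℝ → ℝ, P = fun y => ∫ t in Ioi y, a t := ⟨_, rfl⟩
  have hP0 : ∀ y, 0 ≤ P y := fun y => by
    rw [hP]; exact setIntegral_nonneg measurableSet_Ioi fun t _ => ha0 t
  have hPM : ∀ y, P y ≤ ∫ t, a t := fun y => by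
    rw [hP]; exact setIntegral_le_integral hai (Eventually.of_forall ha0)
  have hPeq : ∀ z, P z = P 0 - ∫ t in (0 : ℝ)..z, a t := fun z => by
    have h := intervalIntegral.integral_Ioi_sub_Ioi' (a := (0 : ℝ)) (b := z)
      hai.integrableOn hai.integrableOn
    simp only [hP]
    linarith
  have hPd : ∀ y, HasDerivAt P (-a y) y := fun y => by
    have h2 : HasDerivAt (fun z => ∫ t in (0 : ℝ)..z, a t) (a y) y :=
      intervalIntegral.integral_hasDerivAt_right (hai.intervalIntegrable)
        (hai.aestronglyMeasurable.stronglyMeasurableAtFilter) hac.continuousAt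
    have h3 := (hasDerivAt_const y (P 0)).sub h2
    rw [zero_sub] at h3
    exact h3.congr_of_eventuallyEq (Eventually.of_forall hPeq)
  have hPc : Continuous P := continuous_iff_continuousAt.2 fun y => (hPd y).continuousAt
  have hPt : Tendsto P atTop (𝓝 0) := by
    have h := tendsto_setIntegral_of_antitone (μ := volume) (f := a) (s := fun y : ℝ => Ioi y)
      (fun _ => measurableSet_Ioi) (fun _ _ h => Ioi_subset_Ioi h) ⟨0, hai.integrableOn⟩
    have he : (⋂ y : ℝ, Ioi y) = ∅ :=
      eq_empty_iff_forall_notMem.2 fun x hx => lt_irrefl x (mem_iInter.1 hx x)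
    rw [he, setIntegral_empty] at h
    rw [hP]
    exact h
  have hWL : ∀ y, Real.exp (2 * P y) ≤ Real.exp (2 * ∫ t, a t) := fun y =>
    Real.exp_le_exp.2 (by linarith [hPM y])
  have hWi : ∀ y, IntegrableOn (fun t => a t * Real.exp (2 * P t)) (Ioi y) := fun y =>
    (hai.mul_bdd (Continuous.aestronglyMeasurable (by fun_prop))
      (Eventually.of_forall fun t => by
        rw [Real.norm_of_nonneg (Real.exp_pos _).le]; exact hWL t)).integrableOn
  refine ⟨fun y => Real.exp (2 * P y), by fun_prop, fun y => Real.one_le_exp (by linarith [hP0 y]),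
    hWL, fun y => ⟨hWi y, ?_⟩⟩
  have hderiv : ∀ x ∈ Ioi y, HasDerivAt (fun t => -(Real.exp (2 * P t) / 2))
      (a x * Real.exp (2 * P x)) x := fun x _ =>
    ((((hPd x).const_mul 2).exp.div_const 2).neg).congr_deriv (by ring)
  have hlim : Tendsto (fun t => -(Real.exp (2 * P t) / 2)) atTop (𝓝 (-(Real.exp (2 * 0) / 2))) :=
    (((Real.continuous_exp.tendsto _).comp (hPt.const_mul 2)).div_const 2).neg
  have h := integral_Ioi_of_hasDerivAt_of_tendsto (Continuous.continuousWithinAt (by fun_prop))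
    hderiv (hWi y) hlim
  rw [h, mul_zero, Real.exp_zero]
  linarith

/-! ## §3 The Volterra operator `(Kf)(y) = ∫_{t>y} k_α(t-y) V(t) f(t) dt` -/

section Operator

variable {k : ℕ} {A α : ℝ} {V : ℝ → ℂ}

/-- The Volterra integrand is integrable on `(y, ∞)` for continuous `f` of polynomial growth of
order `k` (dominated by `(1+|y|) D · A(1+|t|)^{k+1} e^{-t²/4}`). [folklore] -/
theorem integrableOn_volterra (hα : 0 ≤ α) (hV : Continuous V)
    (hVb : ∀ t, ‖V t‖ ≤ A * Real.exp (-(t ^ 2) / 4)) {f : ℝ → ℂ} (hf : Continuous f) {D : ℝ}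
    (hfb : ∀ t, ‖f t‖ ≤ D * (1 + |t|) ^ k) (y : ℝ) :
    IntegrableOn (fun t => (volterraKernel α (t - y) : ℂ) * V t * f t) (Ioi y) := by
  have hkc := continuous_volterraKernel α
  have hg : Integrable fun t : ℝ =>
      (1 + |y|) * D * (A * ((1 + |t|) ^ (k + 1) * Real.exp (-(t ^ 2) / 4))) :=
    ((integrable_pow_mul_gauss (k + 1)).const_mul A).const_mul _
  refine hg.integrableOn.mono' (Continuous.aestronglyMeasurable (by fun_prop)) ?_
  refine ae_restrict_of_forall_mem measurableSet_Ioi fun t (ht : y < t) => ?_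
  calc ‖(volterraKernel α (t - y) : ℂ) * V t * f t‖
      ≤ (1 + |y|) * ((1 + |t|) * (A * Real.exp (-(t ^ 2) / 4))) * ‖f t‖ :=
        norm_integrand_le hα hVb f ht
    _ ≤ (1 + |y|) * ((1 + |t|) * (A * Real.exp (-(t ^ 2) / 4))) * (D * (1 + |t|) ^ k) := by
        have hA : 0 ≤ A := by have := (norm_nonneg _).trans (hVb 0); simpa using this
        exact mul_le_mul_of_nonneg_left (hfb t) (by positivity)
    _ = (1 + |y|) * D * (A * ((1 + |t|) ^ (k + 1) * Real.exp (-(t ^ 2) / 4))) := by ring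

/-- **The key weighted bound.** If `‖f t‖ ≤ D (1+|t|)^k W(t)` with the Bielecki weight `W` of
`a = A(1+|t|)^{k+1}e^{-t²/4}`, then `‖(Kf)(y)‖ ≤ (D/2) (1+|y|)^k W(y)` (`k ≥ 1`): the operator is a
`1/2`-contraction in the weighted sup norm. [folklore] -/
theorem norm_volterra_le (hk : 1 ≤ k) (hα : 0 ≤ α)
    (hVb : ∀ t, ‖V t‖ ≤ A * Real.exp (-(t ^ 2) / 4)) {W : ℝ → ℝ} (hW1 : ∀ y, 1 ≤ W y)
    (hWi : ∀ y, IntegrableOn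
      (fun t => A * ((1 + |t|) ^ (k + 1) * Real.exp (-(t ^ 2) / 4)) * W t) (Ioi y))
    (hWle : ∀ y, ∫ t in Ioi y, A * ((1 + |t|) ^ (k + 1) * Real.exp (-(t ^ 2) / 4)) * W t ≤ W y / 2)
    {f : ℝ → ℂ} {D : ℝ} (hD : 0 ≤ D) (hfb : ∀ t, ‖f t‖ ≤ D * ((1 + |t|) ^ k * W t)) (y : ℝ) :
    ‖∫ t in Ioi y, (volterraKernel α (t - y) : ℂ) * V t * f t‖ ≤ D / 2 * ((1 + |y|) ^ k * W y) := by
  have hbound : ∀ᵐ t ∂(volume.restrict (Ioi y)), ‖(volterraKernel α (t - y) : ℂ) * V t * f t‖ ≤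
      (1 + |y|) * D * (A * ((1 + |t|) ^ (k + 1) * Real.exp (-(t ^ 2) / 4)) * W t) := by
    refine ae_restrict_of_forall_mem measurableSet_Ioi fun t (ht : y < t) => ?_
    calc ‖(volterraKernel α (t - y) : ℂ) * V t * f t‖
        ≤ (1 + |y|) * ((1 + |t|) * (A * Real.exp (-(t ^ 2) / 4))) * ‖f t‖ :=
          norm_integrand_le hα hVb f ht
      _ ≤ (1 + |y|) * ((1 + |t|) * (A * Real.exp (-(t ^ 2) / 4))) * (D * ((1 + |t|) ^ k * W t)) := by
          have hA : 0 ≤ A := by have := (norm_nonneg _).trans (hVb 0); simpa using this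
          exact mul_le_mul_of_nonneg_left (hfb t) (by positivity)
      _ = (1 + |y|) * D * (A * ((1 + |t|) ^ (k + 1) * Real.exp (-(t ^ 2) / 4)) * W t) := by ring
  have h1 := norm_integral_le_of_norm_le ((hWi y).const_mul ((1 + |y|) * D)) hbound
  rw [integral_const_mul] at h1
  have hyk : (1 + |y|) ≤ (1 + |y|) ^ k := le_self_pow₀ (by linarith [abs_nonneg y]) (by omega)
  have hW0 : 0 ≤ W y := zero_le_one.trans (hW1 y)
  calc ‖∫ t in Ioi y, (volterraKernel α (t - y) : ℂ) * V t * f t‖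
      ≤ (1 + |y|) * D *
          ∫ t in Ioi y, A * ((1 + |t|) ^ (k + 1) * Real.exp (-(t ^ 2) / 4)) * W t := h1
    _ ≤ (1 + |y|) * D * (W y / 2) := by gcongr; exact hWle y
    _ = D / 2 * W y * (1 + |y|) := by ring
    _ ≤ D / 2 * W y * (1 + |y|) ^ k := mul_le_mul_of_nonneg_left hyk (by positivity)
    _ = D / 2 * ((1 + |y|) ^ k * W y) := by ring

/-- `y ↦ (Kf)(y)` is continuous for continuous `f` of polynomial growth of order `k`
(dominated convergence for `∫_ℝ k_α((t-y)₊) V(t) f(t) dt`, which is jointly continuous since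
`k_α(0) = 0`). [folklore] -/
theorem continuous_volterra (hα : 0 ≤ α) (hV : Continuous V)
    (hVb : ∀ t, ‖V t‖ ≤ A * Real.exp (-(t ^ 2) / 4)) {f : ℝ → ℂ} (hf : Continuous f) {D : ℝ}
    (hfb : ∀ t, ‖f t‖ ≤ D * (1 + |t|) ^ k) :
    Continuous fun y => ∫ t in Ioi y, (volterraKernel α (t - y) : ℂ) * V t * f t := by
  have hD : 0 ≤ D := by have := (norm_nonneg _).trans (hfb 0); simpa using this
  have hA : 0 ≤ A := by have := (norm_nonneg _).trans (hVb 0); simpa using this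
  have hkc := continuous_volterraKernel α
  have heq : (fun y => ∫ t in Ioi y, (volterraKernel α (t - y) : ℂ) * V t * f t) =
      fun y => ∫ t, (volterraKernel α (max (t - y) 0) : ℂ) * V t * f t := by
    funext y
    calc ∫ t in Ioi y, (volterraKernel α (t - y) : ℂ) * V t * f t
        = ∫ t in Ioi y, (volterraKernel α (max (t - y) 0) : ℂ) * V t * f t :=
          setIntegral_congr_fun measurableSet_Ioi fun t (ht : y < t) => by
            rw [max_eq_left (sub_nonneg.2 ht.le)]
      _ = ∫ t, (volterraKernel α (max (t - y) 0) : ℂ) * V t * f t :=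
          setIntegral_eq_integral_of_forall_compl_eq_zero fun t ht => by
            simp only [mem_Ioi, not_lt] at ht
            rw [max_eq_right (by linarith), volterraKernel_zero]
            simp
  rw [heq]
  refine continuous_iff_continuousAt.2 fun y₀ => ?_
  have hbi : Integrable fun t : ℝ =>
      (2 + |y₀|) * D * (A * ((1 + |t|) ^ (k + 1) * Real.exp (-(t ^ 2) / 4))) :=
    ((integrable_pow_mul_gauss (k + 1)).const_mul A).const_mul _
  have hball : ∀ᶠ y in 𝓝 y₀, |y - y₀| < 1 := by
    filter_upwards [Metric.ball_mem_nhds y₀ one_pos] with y hy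
    rwa [Metric.mem_ball, Real.dist_eq] at hy
  refine continuousAt_of_dominated (Eventually.of_forall fun y => ?_) ?_ hbi
    (Eventually.of_forall fun t => ?_)
  · exact (((Complex.continuous_ofReal.comp (hkc.comp
      ((continuous_id.sub continuous_const).max continuous_const))).mul hV).mul hf).aestronglyMeasurable
  · filter_upwards [hball] with y hy
    refine Eventually.of_forall fun t => ?_
    rcases le_or_gt t y with hty | hty
    · rw [max_eq_right (by linarith), volterraKernel_zero]
      simp only [Complex.ofReal_zero, zero_mul, norm_zero]
      positivity
    · rw [max_eq_left (sub_nonneg.2 hty.le)]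
      have hy1 : 1 + |y| ≤ 2 + |y₀| := by linarith [abs_sub_abs_le_abs_sub y y₀]
      calc ‖(volterraKernel α (t - y) : ℂ) * V t * f t‖
          ≤ (1 + |y|) * ((1 + |t|) * (A * Real.exp (-(t ^ 2) / 4))) * ‖f t‖ :=
            norm_integrand_le hα hVb f hty
        _ ≤ (2 + |y₀|) * ((1 + |t|) * (A * Real.exp (-(t ^ 2) / 4))) * (D * (1 + |t|) ^ k) := by
            gcongr
            exact hfb t
        _ = (2 + |y₀|) * D * (A * ((1 + |t|) ^ (k + 1) * Real.exp (-(t ^ 2) / 4))) := by ring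
  · exact (((Complex.continuous_ofReal.comp (hkc.comp
      ((continuous_const.sub continuous_id).max continuous_const))).mul continuous_const).mul
        continuous_const).continuousAt

end Operator

/-- **Registered sub-goal `volterra_partA`** (Pi-form of `continuous_volterra`): the Volterra operator
`y ↦ ∫_{t>y} k_α(t-y) V(t) f(t) dt` of a Gaussian-class potential maps continuous functions of polynomial
growth of order `k` to continuous functions. [folklore] -/
theorem volterra_partA : ∀ (k : ℕ) (A α : ℝ) (V f : ℝ → ℂ) (D : ℝ), 0 ≤ α → Continuous V → (∀ t : ℝ, ‖V t‖ ≤ A * Real.exp (-(t ^ 2) / 4)) → Continuous f → (∀ t : ℝ, ‖f t‖ ≤ D * (1 + |t|) ^ k) → Continuous fun y : ℝ => ∫ t in Set.Ioi y, (volterraKernel α (t - y) : ℂ) * V t * f t :=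
  fun _ _ _ _ _ _ hα hV hVb hf hfb => continuous_volterra hα hV hVb hf hfb

end Summit.AnomalousDissipation.AnomalousDissipation.Theorems.BurgersLayerKH.Sheet.Volterra

end
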